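import Summits.HodgeConjecture.HodgeConjecture.Theorems.F0P3cStCharTSWeylHypMeasure     -- ★ p849733 (LH2-p02 (g3)): `exists_conjFamily`, §2 radial-`∫⁻`-to-Bochner transport (`map_prod_eq_smul_restrict_of_lintegral_radial`, `integrable_and_integral_eq_smul_of_lintegral_radial`)
import Summits.HodgeConjecture.HodgeConjecture.Theorems.F0P3cStCharTSWeylFinite         -- ★ p851489 WEYL-FIN (F0P3a-p03 (g23)): `index_centralizer_subgroupOf_normalizer_ne_zero`
import Literature.NumberTheory.Rogawski1990.LocalEndoscopicChartDatumCM                  -- ★ `isOpen_setOf_isRegularElt_cmDatum_local` (regular locus open, non-split place)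
import Literature.NumberTheory.Automorphic.StableCentralizerEquivCM                       -- ★ `commute_of_commute_of_isRegularElt_local` (the commutant of a regular element is commutative)
import HarnessLib

/-!
# F0 · P3c · line LH6 «StCharTS» — «ELL-TOR★»: THE RADIAL WEYL INTEGRATION FORMULA ON THE `T`-REGULAR SET FOR EVERY CARTAN SUBGROUP `T = Z(γ₀)` OF `U(Φ₃)(L⁺_v)`,
# UNCONDITIONAL (Harish-Chandra 1970 Lemma 42 ∕ Weil 1965 n° 49 ∕ Federer §2.10.10, instantiated at an ARBITRARY Cartan; Rogawski 1990 §12.5 p. 182)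

Cell `pub/hodgecm-mathlib`, crux H413 = `stmt-HodgeConjecture-24833` (lane `--supports`, helper; route HCCMUnconditional); seat F0P3a-p05 (g22); NAMING «ELL-TOR★»
2026-09-02T14:19:42Z (census-first, road rule §2.3; the elliptic twin of the (TOR) road's stage (B) ★ p849733).  THEOREMS ONLY; sorry-free; no definition ∕ instance ∕
notation ∕ named fact; axioms TRIO.

THE POINT.  ★ p849733 `exists_radialMeasure_lintegral_hypSet` instantiates the Jacobian-free Weyl integration formula ★
`Literature.MeasureTheory.Group.exists_radialMeasure_lintegral_conjFamily` at the SPLIT diagonal torus `M` of `G = U(Φ₃)(L⁺_v)` only (`|W| = 2`, the hyperbolic set `Ω`).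
Print's formula [Rogawski1990 §12.5 p. 182] runs over ALL conjugacy classes of Cartan subgroups; at a non-split `v` the non-split ones are the COMPACT centralisers
`T = Z(γ₀)` of regular elliptic `γ₀` (★ `F0P3cStCharTSEllCartanCompact.isCompact_centralizer_iff_not_mem_hyperbolicSet`).  This file instantiates the same engine at
`T = Z(γ₀)` for ANY regular `γ₀ ∈ G` — every hypothesis of the engine being ALREADY ★ at that `T`:
* `T` closed: Mathlib `Set.isClosed_centralizer`; `T` abelian: ★ `commute_of_commute_of_isRegularElt_local` (the `GL₃(∏ L_w)`-commutant of a regular element is commutative);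
* the Weyl group `N(T)∕T` finite: ★ WEYL-FIN `index_centralizer_subgroupOf_normalizer_ne_zero` (token shape identical to the engine's `hW`);
* «regular set» `R := {g | IsRegularElt g}` (ALL regular elements): Borel (open, ★ `isOpen_setOf_isRegularElt_cmDatum_local`), conjugation-invariant (★ `isRegularElt_conj_iff`),
  and every regular `t ∈ T` has `Z(t) = T` (★ S9a `F0P3cStCharTSCartanFields.centralizer_eq_of_mem_centralizer` — the commutants of two commuting regular elements coincide);
* the conjugation family `Φ(xT, t) = x t x⁻¹`: ★ p849733 `exists_conjFamily` (the parameter-pinned-by-an-equation idiom).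
So the `T`-REGULAR SET `G_T := ⋃ₓ x T^{reg} x⁻¹ = Φ(G⧸T × T^{reg})` (for `T` compact: the part of the regular elliptic set whose centralisers are conjugate to `T`; for
`T = M`: the hyperbolic set `Ω` of ★ p849733, re-obtained with `2` replaced by `[N(M) : M]`) carries

  **`[N(T) : T] · ∫⁻_{G_T} f dν = ∫⁻_T ∫⁻_{G ⧸ T} f(Φ(q, t)) d(ν∕tm)(q) dσ_T(t)`**   (every Borel `f ≥ 0`)

for a measure `σ_T` on `T`, finite on compact sets, σ-finite and CARRIED BY `T^{reg}` (`exists_radialMeasure_lintegral_cartanSet`), with the measure form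
`(σ_T ⊗ (ν∕tm)) ∘ Φ̃⁻¹ = [N(T):T] · ν|_{G_T}` and the ℂ-valued BOCHNER form `∫_T ∫_{G⧸T} g(Φ(q,t)) = [N(T):T] • ∫_{G_T} g dν` (`exists_radialMeasure_integral_cartanSet`, ★ p849733 §2
transport), and `G_T` is Borel (`measurableSet_cartanSet`, Lusin–Souslin through the engine's local injectivity ★ `exists_isOpen_injOn_conjFamily`).  Classically
`dσ_T = |D_G(t)| dtm(t)` [HarishChandra1970 L. 22]; that identification (the Jacobian of conjugation at a compact Cartan) is NOT asserted here — it is the socket of the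
sequel «JAC-CARTAN BY SHAPE», exactly as ★ p849811 ∕ ★ p851645 are for `M`.

CARRIER.  Everything is typed on `Gqs L v = (cmDatum L 3 Φ₃).Local v` with `T : Subgroup (Gqs L v)` and `hT : T = Subgroup.centralizer {γ₀}` (the shape of RUNG0's `hcartO`
∕ PLAN-S9 D1 «`IsCartanSubgroup T := ∃ γ ∈ T, IsRegularElt γ ∧ T = Z(γ)`»), the five topological ∕ measurable structures on `Gqs L v` and the two on `Gqs L v ⧸ T` being
instance ARGUMENTS (as in ★ p849733: the caller's `locallyCompactSpace_local` ∕ `secondCountableTopology_local` ∕ `t2Space_cmDatum_local` terms and Borel σ-algebras), the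
Haar data `ν` on `G` and `tm` on `T` parameters with ★ `quotientMeasure`'s standing instance hypotheses.

HONEST LABEL: count-neutral (TOR)-road measure theory for the WIF antecedent of the LH6 rung-0 block, now uniform over all Cartans; closes no organ.  HC_CM is proved only
modulo the 7 printed citations (2 remaining: hLiu418 = `stmt-HodgeConjecture-24832`, h413 = `stmt-HodgeConjecture-24833`) until rung 0 closes.

## References
* [Rogawski1990] J. D. Rogawski, *Automorphic Representations of Unitary Groups in Three Variables*, Ann. of Math. Stud. 123 (1990), §12.5 p. 182 (Weyl integration
  over representatives of the conjugacy classes of Cartan subgroups), §3.1 p. 19, §3.6 pp. 28–31 (Cartan subgroups of `U(3)`).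
* [HarishChandra1970] Harish-Chandra, *Harmonic analysis on reductive p-adic groups*, LNM 162 (1970), Lemma 42 (and Lemma 22 for the Jacobian).
* [Weil1965] A. Weil, *Sur la formule de Siegel dans la théorie des groupes classiques*, Acta Math. 113 (1965), n° 49 Lemme 22 (p. 70).
* [Federer1969] H. Federer, *Geometric Measure Theory* (1969), §2.10.10.
-/

set_option autoImplicit false
-- the mandated namespace has the single-problem summit's repeated segment (`HodgeConjecture.HodgeConjecture`)
set_option linter.dupNamespace false

noncomputable section

open MeasureTheory Measure Set Filter Topology Function NumberField IsDedekindDomain Matrix Polynomial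
open Literature.MeasureTheory.Group
open Literature.NumberTheory.Automorphic Literature.NumberTheory.Automorphic.UnitaryGroup Literature.NumberTheory.Rogawski1990
open Summit.HodgeConjecture.HodgeConjecture.Cruxes.H413.F0P3cStCharTSWeylHypMeasure
open scoped ENNReal NNReal MatrixGroups Pointwise

namespace Summit.HodgeConjecture.HodgeConjecture.Cruxes.H413.F0P3cStCharTSWeylCartanRadial

variable (L : Type) [Field L] [NumberField L] [IsCMField L] (v : HeightOneSpectrum (𝓞 ↥(maximalRealSubfield L)))

/-! ## §1 The Cartan subgroup `Z(γ₀)` of a regular `γ₀`: abelian, closed, self-centralising at its regular elements; the regular locus is conjugation-invariant -/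

/-- Equality in `U(Φ₃)(L⁺_v)` is equality of the underlying matrices, multiplicatively: `a b = b a ↔` the matrices commute. [cite: Rogawski1990, §3.1 p. 19] -/
theorem mul_eq_mul_iff_commute_val (a b : Gqs L v) :
    a * b = b * a ↔ Commute (a.val : GL (Fin 3) (LocalRing L v)).val (b.val : GL (Fin 3) (LocalRing L v)).val := by
  constructor
  · intro h
    have h' := congrArg (fun g : Gqs L v => (g.val : GL (Fin 3) (LocalRing L v)).val) h
    exact h'
  · intro h
    apply Subtype.ext
    apply Units.ext
    exact h.eq

/-- **`Z(γ₀)` is ABELIAN for a regular `γ₀`**: two elements commuting with a regular semisimple matrix commute with each other (★ `commute_of_commute_of_isRegularElt_local`: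
the commutant of a matrix with separable characteristic polynomial over `∏_{w ∣ v} L_w` is commutative). [cite: Rogawski1990, §3.1 p. 19; §3.6 p. 28] -/
theorem mul_comm_of_mem_centralizer {γ₀ : Gqs L v} (hγ₀ : IsRegularElt (γ₀.val : GL (Fin 3) (LocalRing L v))) :
    ∀ a ∈ Subgroup.centralizer ({γ₀} : Set (Gqs L v)), ∀ b ∈ Subgroup.centralizer ({γ₀} : Set (Gqs L v)), a * b = b * a := by
  intro a ha b hb
  rw [Subgroup.mem_centralizer_singleton_iff] at ha hb
  have ha' := (mul_eq_mul_iff_commute_val L v a γ₀).1 ha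
  have hb' := (mul_eq_mul_iff_commute_val L v b γ₀).1 hb
  exact (mul_eq_mul_iff_commute_val L v a b).2 (commute_of_commute_of_isRegularElt_local L v γ₀ hγ₀ _ _ ha' hb')

/-- `Z(γ₀)` is closed (Mathlib `Set.isClosed_centralizer`). [cite: Rogawski1990, §3.1 p. 19] -/
theorem isClosed_coe_centralizer [T2Space (Gqs L v)] (γ₀ : Gqs L v) : IsClosed ((Subgroup.centralizer ({γ₀} : Set (Gqs L v)) : Subgroup (Gqs L v)) : Set (Gqs L v)) :=
  Set.isClosed_centralizer ({γ₀} : Set (Gqs L v))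

/-- **`Z(t) = Z(γ₀)` for every REGULAR `t ∈ Z(γ₀)`** (`γ₀` regular): both commutants are commutative and contain each other's generator.  The engine's hypothesis `hRT` at
`R = {regular}`. [cite: Rogawski1990, §3.1 p. 19; §3.6 p. 28] -/
theorem centralizer_eq_of_mem_centralizer_of_isRegularElt {γ₀ : Gqs L v} (hγ₀ : IsRegularElt (γ₀.val : GL (Fin 3) (LocalRing L v))) {t : Gqs L v}
    (ht : t ∈ Subgroup.centralizer ({γ₀} : Set (Gqs L v))) (htreg : IsRegularElt (t.val : GL (Fin 3) (LocalRing L v))) :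
    Subgroup.centralizer ({t} : Set (Gqs L v)) = Subgroup.centralizer ({γ₀} : Set (Gqs L v)) := by
  rw [Subgroup.mem_centralizer_singleton_iff] at ht
  have htc := (mul_eq_mul_iff_commute_val L v t γ₀).1 ht
  ext x
  rw [Subgroup.mem_centralizer_singleton_iff, Subgroup.mem_centralizer_singleton_iff, mul_eq_mul_iff_commute_val, mul_eq_mul_iff_commute_val]
  constructor
  · intro hx
    exact commute_of_commute_of_isRegularElt_local L v t htreg _ _ hx htc.symm
  · intro hx
    exact commute_of_commute_of_isRegularElt_local L v γ₀ hγ₀ _ _ hx htc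

/-- Regularity is invariant under conjugation in `U(Φ₃)(L⁺_v)` (★ `isRegularElt_conj_iff` on the matrix carrier). [cite: Rogawski1990, §3.1 p. 19] -/
theorem isRegularElt_conj_val_iff (g x : Gqs L v) :
    IsRegularElt (((g * x * g⁻¹ : Gqs L v)).val : GL (Fin 3) (LocalRing L v)) ↔ IsRegularElt (x.val : GL (Fin 3) (LocalRing L v)) :=
  isRegularElt_conj_iff (g.val : GL (Fin 3) (LocalRing L v)) (x.val : GL (Fin 3) (LocalRing L v))

/-- The regular locus of `U(Φ₃)(L⁺_v)` is Borel (it is open at a non-split place, ★ `isOpen_setOf_isRegularElt_cmDatum_local`). [cite: Rogawski1990, §3.1 p. 19] -/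
theorem measurableSet_setOf_isRegularElt (hns : ∀ w : PlacesOver L v, IsCMField.complexConj L • w.1 = w.1) [MeasurableSpace (Gqs L v)] [BorelSpace (Gqs L v)] :
    MeasurableSet {g : Gqs L v | IsRegularElt (g.val : GL (Fin 3) (LocalRing L v))} := by
  obtain ⟨w⟩ := (inferInstance : Nonempty (PlacesOver L v))
  exact (isOpen_setOf_isRegularElt_cmDatum_local (L := L) (H := qsForm L) (v := v) w (hns w)).measurableSet

/-! ## §2 The `T`-regular set `G_T = ⋃ₓ x T^{reg} x⁻¹` of a Cartan subgroup `T = Z(γ₀)` is Borel -/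

section Cartan

variable {L v}
variable {T : Subgroup (Gqs L v)} {γ₀ : Gqs L v} (hγ₀ : IsRegularElt (γ₀.val : GL (Fin 3) (LocalRing L v)))
  (hT : T = Subgroup.centralizer ({γ₀} : Set (Gqs L v)))

include hT in
/-- `T = Z(γ₀)` is closed. [cite: Rogawski1990, §3.1 p. 19] -/
theorem isClosed_cartan [T2Space (Gqs L v)] : IsClosed (T : Set (Gqs L v)) := by
  rw [hT]; exact isClosed_coe_centralizer L v γ₀

include hγ₀ hT in
/-- `T = Z(γ₀)` is abelian (`γ₀` regular). [cite: Rogawski1990, §3.6 p. 28] -/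
theorem mul_comm_cartan : ∀ a ∈ T, ∀ b ∈ T, a * b = b * a := by
  subst hT; exact mul_comm_of_mem_centralizer L v hγ₀

include hγ₀ hT in
/-- Every regular `t ∈ T = Z(γ₀)` has `Z(t) = T` (the engine's `hRT` at `R = {regular}`). [cite: Rogawski1990, §3.6 p. 28] -/
theorem centralizer_eq_cartan_of_isRegularElt (t : ↥T) (ht : IsRegularElt ((t : Gqs L v).val : GL (Fin 3) (LocalRing L v))) :
    Subgroup.centralizer ({(t : Gqs L v)} : Set (Gqs L v)) = T := by
  subst hT; exact centralizer_eq_of_mem_centralizer_of_isRegularElt L v hγ₀ t.2 ht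

include hγ₀ hT in
/-- **`[N(T) : T] ≠ 0`** for `T = Z(γ₀)` (★ WEYL-FIN, non-split `v`) — the engine's `hW`. [cite: Rogawski1990, §3.5 p. 28] [cite: HarishChandra1970, Lemma 42] -/
theorem index_cartan_subgroupOf_normalizer_ne_zero (hns : ∀ w : PlacesOver L v, IsCMField.complexConj L • w.1 = w.1) :
    (T.subgroupOf (Subgroup.normalizer (T : Set (Gqs L v)))).index ≠ 0 := by
  subst hT; exact F0P3cStCharTSWeylFinite.index_centralizer_subgroupOf_normalizer_ne_zero L v hns γ₀ hγ₀

variable (Φ : (Gqs L v ⧸ T) × ↥T → Gqs L v) (hΦ : ∀ (x : Gqs L v) (t : ↥T), Φ (QuotientGroup.mk x, t) = x * t * x⁻¹)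

include hΦ in
/-- **The `T`-regular set is the image of the regular part of `G ⧸ T × T` under `Φ`**: `Φ '' {p | p.2 regular} = {x | ∃ g, ∃ t ∈ T, t regular ∧ g t g⁻¹ = x}` (stated with the
engine's membership spelling `↑p.2 ∈ {g | IsRegularElt g}` on the left). [cite: HarishChandra1970, Lemma 42] -/
theorem image_conjFamily_regular_eq :
    Φ '' {p : (Gqs L v ⧸ T) × ↥T | ((p.2 : ↥T) : Gqs L v) ∈ {g : Gqs L v | IsRegularElt (g.val : GL (Fin 3) (LocalRing L v))}} =
      {x | ∃ g t : Gqs L v, t ∈ T ∧ IsRegularElt (t.val : GL (Fin 3) (LocalRing L v)) ∧ g * t * g⁻¹ = x} := by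
  ext x
  constructor
  · rintro ⟨⟨q, t⟩, ht, rfl⟩
    obtain ⟨g, rfl⟩ := QuotientGroup.mk_surjective q
    exact ⟨g, t, t.2, ht, (hΦ g t).symm⟩
  · rintro ⟨g, t, htT, ht, rfl⟩
    exact ⟨(QuotientGroup.mk g, ⟨t, htT⟩), ht, hΦ g ⟨t, htT⟩⟩

variable (hns : ∀ w : PlacesOver L v, IsCMField.complexConj L • w.1 = w.1)
  [MeasurableSpace (Gqs L v)] [BorelSpace (Gqs L v)] [LocallyCompactSpace (Gqs L v)] [SecondCountableTopology (Gqs L v)] [T2Space (Gqs L v)]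
  [MeasurableSpace (Gqs L v ⧸ T)] [BorelSpace (Gqs L v ⧸ T)]

include hns hγ₀ hT hΦ in
/-- **The `T`-regular set `G_T = ⋃ₓ x T^{reg} x⁻¹` is BOREL** (Lusin–Souslin: `Φ` is continuous and locally injective on the Borel regular part of the Polish space `G⧸T × T`,
★ `exists_isOpen_injOn_conjFamily` + ★ `measurableSet_image_inter_of_locallyInjOn`). [cite: Federer1969, §2.10.10] [cite: HarishChandra1970, Lemma 42] -/
theorem measurableSet_cartanSet :
    MeasurableSet {x | ∃ g t : Gqs L v, t ∈ T ∧ IsRegularElt (t.val : GL (Fin 3) (LocalRing L v)) ∧ g * t * g⁻¹ = x} := by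
  classical
  have hTc := isClosed_cartan hT
  have hTa := mul_comm_cartan hγ₀ hT
  have hW0 := index_cartan_subgroupOf_normalizer_ne_zero hγ₀ hT hns
  haveI : PolishSpace ((Gqs L v ⧸ T) × ↥T) := polishSpace_quotient_prod_subgroup T hTc
  have hΦc : Continuous Φ := (continuous_conjFamily_and_smul T Φ hΦ).1
  haveI : SecondCountableTopology ↥T := TopologicalSpace.Subtype.secondCountableTopology _
  haveI : BorelSpace ((Gqs L v ⧸ T) × ↥T) := Prod.borelSpace
  have hRm := measurableSet_setOf_isRegularElt L v hns
  have hD₀ : MeasurableSet {p : (Gqs L v ⧸ T) × ↥T | ((p.2 : ↥T) : Gqs L v) ∈ {g : Gqs L v | IsRegularElt (g.val : GL (Fin 3) (LocalRing L v))}} :=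
    hRm.preimage (continuous_subtype_val.measurable.comp measurable_snd)
  have hinj : ∀ z ∈ {p : (Gqs L v ⧸ T) × ↥T | ((p.2 : ↥T) : Gqs L v) ∈ {g : Gqs L v | IsRegularElt (g.val : GL (Fin 3) (LocalRing L v))}},
      ∃ U : Set ((Gqs L v ⧸ T) × ↥T), IsOpen U ∧ z ∈ U ∧
        InjOn Φ (U ∩ {p | ((p.2 : ↥T) : Gqs L v) ∈ {g : Gqs L v | IsRegularElt (g.val : GL (Fin 3) (LocalRing L v))}}) := fun z _ =>
    exists_isOpen_injOn_conjFamily T hTc hTa Φ hΦ {x : Gqs L v | IsRegularElt (x.val : GL (Fin 3) (LocalRing L v))}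
      (fun t ht => centralizer_eq_cartan_of_isRegularElt hγ₀ hT t ht) hW0 z
  rw [← image_conjFamily_regular_eq Φ hΦ,
    ← Set.univ_inter {p : (Gqs L v ⧸ T) × ↥T | ((p.2 : ↥T) : Gqs L v) ∈ {g : Gqs L v | IsRegularElt (g.val : GL (Fin 3) (LocalRing L v))}}]
  exact measurableSet_image_inter_of_locallyInjOn hD₀ hΦc hinj MeasurableSet.univ

/-! ## §3 THE RADIAL WEYL INTEGRATION FORMULA ON `G_T`, UNCONDITIONAL -/

variable (ν : Measure (Gqs L v)) [ν.IsHaarMeasure] [ν.IsMulRightInvariant]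
  (tm : Measure ↥T) [tm.IsMulLeftInvariant] [IsFiniteMeasureOnCompacts tm] [tm.IsOpenPosMeasure] [tm.IsInvInvariant]

include hns hγ₀ hΦ in
/-- **«ELL-TOR★»: THE WEYL INTEGRATION FORMULA ON THE `T`-REGULAR SET OF A CARTAN SUBGROUP `T = Z(γ₀)` OF `U(Φ₃)(L⁺_v)`, RADIAL FORM (UNCONDITIONAL).**  `v` non-split,
`γ₀` regular, `ν` a Haar measure on `G`, `tm` a Haar measure on `T`, `Φ(xT, t) = x t x⁻¹`.  There is a measure `σ` on `T`, finite on compact sets, σ-finite and CARRIED BY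
`T^{reg}`, such that for every Borel `f ≥ 0` on `G`
**`[N(T) : T] · ∫⁻_{G_T} f dν = ∫⁻_T ∫⁻_{G ⧸ T} f(Φ(q, t)) d(ν∕tm)(q) dσ(t)`**, `G_T = {g t g⁻¹ | t ∈ T regular}`, `ν∕tm` = ★ `quotientMeasure` — ★ `exists_radialMeasure_lintegral_conjFamily`
with «regular set» `R := {g | IsRegularElt g}`, every hypothesis discharged by name (§1–§2).  For `T` the split torus this is ★ p849733 (`[N(M):M] = 2`); for `T` compact it is
the ELLIPTIC radial formula.  Classically `dσ = |D_G(t)| dtm(t)` (NOT asserted). [cite: Rogawski1990, §12.5 p. 182] [cite: HarishChandra1970, Lemma 42]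
[cite: Weil1965, n° 49 Lemme 22 (p. 70)] [cite: Federer1969, §2.10.10] -/
theorem exists_radialMeasure_lintegral_cartanSet :
    ∃ σ : Measure ↥T, IsFiniteMeasureOnCompacts σ ∧ SigmaFinite σ ∧
      σ {t : ↥T | ¬ IsRegularElt (((t : Gqs L v)).val : GL (Fin 3) (LocalRing L v))} = 0 ∧
      ∀ f : Gqs L v → ℝ≥0∞, Measurable f →
        ((T.subgroupOf (Subgroup.normalizer (T : Set (Gqs L v)))).index : ℝ≥0∞) *
            ∫⁻ y in {x | ∃ g t : Gqs L v, t ∈ T ∧ IsRegularElt (t.val : GL (Fin 3) (LocalRing L v)) ∧ g * t * g⁻¹ = x}, f y ∂ν =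
          ∫⁻ t, ∫⁻ q, f (Φ (q, t)) ∂(quotientMeasure T tm (isClosed_cartan hT) ν) ∂σ := by
  classical
  have hTc := isClosed_cartan hT
  have hTa := mul_comm_cartan hγ₀ hT
  have hW0 := index_cartan_subgroupOf_normalizer_ne_zero hγ₀ hT hns
  have hRm := measurableSet_setOf_isRegularElt L v hns
  have hRT : ∀ t : ↥T, (t : Gqs L v) ∈ {x : Gqs L v | IsRegularElt (x.val : GL (Fin 3) (LocalRing L v))} →
      Subgroup.centralizer ({(t : Gqs L v)} : Set (Gqs L v)) = T := fun t ht =>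
    centralizer_eq_cartan_of_isRegularElt hγ₀ hT t ht
  have hRc : ∀ g x : Gqs L v, x ∈ {x : Gqs L v | IsRegularElt (x.val : GL (Fin 3) (LocalRing L v))} →
      g * x * g⁻¹ ∈ {x : Gqs L v | IsRegularElt (x.val : GL (Fin 3) (LocalRing L v))} := fun g x hx =>
    (isRegularElt_conj_val_iff L v g x).2 hx
  obtain ⟨σ', hfin, hsf, hcar, hmain⟩ := exists_radialMeasure_lintegral_conjFamily T hTc hTa ν Φ hΦ _ hRm hRT hRc hW0 tm
  refine ⟨σ', hfin, hsf, hcar, fun f hf => ?_⟩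
  have h := hmain f hf
  rwa [image_conjFamily_regular_eq Φ hΦ] at h

include hns hγ₀ hΦ in
/-- **«ELL-TOR★» — measure and Bochner forms** (same `σ` as `exists_radialMeasure_lintegral_cartanSet`): in addition to the `∫⁻` identity,
`(σ ⊗ (ν∕tm)) ∘ Φ̃⁻¹ = [N(T):T] · ν|_{G_T}` as measures on `G` (`Φ̃(t, q) = Φ(q, t)`), and for every `g : G → ℂ` that is `ν`-integrable on `G_T` the integrand `(t, q) ↦ g(Φ(q, t))`
is `σ ⊗ (ν∕tm)`-integrable with **`∫_T ∫_{G ⧸ T} g(Φ(q, t)) d(ν∕tm) dσ = [N(T):T] • ∫_{G_T} g dν`** (★ p849733 §2 transport). [cite: Rogawski1990, §12.5 p. 182]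
[cite: HarishChandra1970, Lemma 42] [cite: Federer1969, §2.10.10] -/
theorem exists_radialMeasure_integral_cartanSet :
    ∃ σ : Measure ↥T, IsFiniteMeasureOnCompacts σ ∧ SigmaFinite σ ∧
      σ {t : ↥T | ¬ IsRegularElt (((t : Gqs L v)).val : GL (Fin 3) (LocalRing L v))} = 0 ∧
      (∀ f : Gqs L v → ℝ≥0∞, Measurable f →
        ((T.subgroupOf (Subgroup.normalizer (T : Set (Gqs L v)))).index : ℝ≥0∞) *
            ∫⁻ y in {x | ∃ g t : Gqs L v, t ∈ T ∧ IsRegularElt (t.val : GL (Fin 3) (LocalRing L v)) ∧ g * t * g⁻¹ = x}, f y ∂ν =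
          ∫⁻ t, ∫⁻ q, f (Φ (q, t)) ∂(quotientMeasure T tm (isClosed_cartan hT) ν) ∂σ) ∧
      (σ.prod (quotientMeasure T tm (isClosed_cartan hT) ν)).map (fun p => Φ (p.2, p.1)) =
        ((T.subgroupOf (Subgroup.normalizer (T : Set (Gqs L v)))).index : ℝ≥0∞) •
          ν.restrict {x | ∃ g t : Gqs L v, t ∈ T ∧ IsRegularElt (t.val : GL (Fin 3) (LocalRing L v)) ∧ g * t * g⁻¹ = x} ∧
      ∀ g : Gqs L v → ℂ,
        IntegrableOn g {x | ∃ g t : Gqs L v, t ∈ T ∧ IsRegularElt (t.val : GL (Fin 3) (LocalRing L v)) ∧ g * t * g⁻¹ = x} ν →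
        Integrable (fun p : ↥T × (Gqs L v ⧸ T) => g (Φ (p.2, p.1))) (σ.prod (quotientMeasure T tm (isClosed_cartan hT) ν)) ∧
          ∫ t, ∫ q, g (Φ (q, t)) ∂(quotientMeasure T tm (isClosed_cartan hT) ν) ∂σ =
            ((T.subgroupOf (Subgroup.normalizer (T : Set (Gqs L v)))).index : ℝ) •
              ∫ y in {x | ∃ g t : Gqs L v, t ∈ T ∧ IsRegularElt (t.val : GL (Fin 3) (LocalRing L v)) ∧ g * t * g⁻¹ = x}, g y ∂ν := by
  obtain ⟨σ', hfin, hsf, hcar, hmain⟩ := exists_radialMeasure_lintegral_cartanSet hγ₀ hT Φ hΦ hns ν tm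
  haveI := hsf
  have hTc := isClosed_cartan hT
  haveI : SecondCountableTopology (Gqs L v ⧸ T) := (QuotientGroup.isQuotientMap_mk _).secondCountableTopology QuotientGroup.isOpenMap_coe
  haveI : LocallyCompactSpace (Gqs L v ⧸ T) := QuotientGroup.instLocallyCompactSpace _
  haveI : SigmaCompactSpace (Gqs L v ⧸ T) := sigmaCompactSpace_of_locallyCompact_secondCountable
  haveI : IsClosed (T : Set (Gqs L v)) := hTc
  haveI : SigmaFinite (quotientMeasure T tm hTc ν) := SigmaFinite.of_isFiniteMeasureOnCompacts _
  haveI : SecondCountableTopology ↥T := TopologicalSpace.Subtype.secondCountableTopology _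
  haveI : BorelSpace ((Gqs L v ⧸ T) × ↥T) := Prod.borelSpace
  have hΦm : Measurable Φ := (continuous_conjFamily_and_smul T Φ hΦ).1.measurable
  exact ⟨σ', hfin, hsf, hcar, hmain, map_prod_eq_smul_restrict_of_lintegral_radial hΦm hmain,
    fun g hg => integrable_and_integral_eq_smul_of_lintegral_radial hΦm hmain g hg⟩

end Cartan

end Summit.HodgeConjecture.HodgeConjecture.Cruxes.H413.F0P3cStCharTSWeylCartanRadial
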